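import Literature.Analysis.OperatorTheory.RieszProjectionContour
import Mathlib.Analysis.Complex.AbsMax
import HarnessLib

/-!
# Pseudospectral enclosure: an approximate eigenvector at the centre of a circle on which the
# resolvent is bounded by `M < 1/ε` forces spectrum inside the circle

Topic `Literature/Analysis/OperatorTheory`; proofs-layer file (theorems only, no definitions, no
named facts), in the Banach-algebra setting of `RieszProjectionContour.lean` (Mathlib's
`resolventSet`, `spectrum`, `resolvent a z = (z − a)⁻¹`).

For an element `a` of a complex Banach algebra `A` (e.g. `A = 𝓛(X)`), a point `μ`, a radius
`r > 0` and numbers `M`, `ε`: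

* `norm_le_norm_resolvent_mul_norm` — the one-line half of the **approximate-eigenvector
  description of pseudospectra** (Davies 2007, Lemma 9.1.2; Trefethen–Embree 2005, §4, the equivalent
  definitions (4.3)–(4.5) of Thm. 4.3): if `μ ∈ ρ(a)` then `‖b‖ ≤ ‖(μ − a)⁻¹‖ · ‖(μ − a) b‖` for every `b`, i.e. a vector
  with `‖(μ − a) b‖ ≤ ε ‖b‖`, `b ≠ 0`, certifies `‖(μ − a)⁻¹‖ ≥ ε⁻¹` (`μ ∈ σ_ε(a)`);
* `spectrum_inter_closedBall_nonempty_of_norm_resolvent_le` — **the enclosure**: if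
  `‖(z − a)⁻¹‖ ≤ M` on the circle `|z − μ| = r` (`r > 0`), and some `b ≠ 0` has
  `‖(μ − a) b‖ ≤ ε ‖b‖` with `M ε < 1`, then `σ(a)` meets the closed disc `|z − μ| ≤ r`.
  (The classical hypothesis "the circle lies in `ρ(a)`" is not needed as a separate assumption:
  if the circle meets `σ(a)` the conclusion holds trivially, and at such points Mathlib's
  `resolvent a z = Ring.inverse (z − a) = 0` makes the bound `‖(z − a)⁻¹‖ ≤ M` harmless — it is
  only ever USED on `ρ(a)`.)
  Proof: otherwise the closed disc lies in `ρ(a)`, the resolvent is holomorphic on a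
  neighbourhood of it (Mathlib `spectrum.hasDerivAt_resolvent_const_left`), and the maximum principle
  for Banach-space-valued holomorphic functions (`Complex.norm_le_of_forall_mem_frontier_norm_le`;
  this is the subharmonicity of `z ↦ ‖(z − a)⁻¹‖`, Davies 2007 Thm. 9.2.8 / Trefethen–Embree
  2005 Thm. 4.2) gives `‖(μ − a)⁻¹‖ ≤ M < ε⁻¹`, contradicting the first item. Equivalently: a
  component of the `ε`-pseudospectrum that is enclosed by a curve on which `‖R‖ ≤ M < 1/ε`
  contains spectrum (Trefethen–Embree 2005, Thm. 2.4 (i) for matrices, Thm. 4.3 for closed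
  operators);
* `spectrum_inter_closedBall_nonempty_of_norm_resolvent_le'` — the same with the residual
  hypothesis in the normalised form `‖b‖ = 1`, `‖(μ − a) b‖ ≤ ε`.

Why it is here: this is the certification step that turns a validated-numerics *residual* bound
for a candidate eigenpair of a NON-NORMAL operator (where a small residual alone proves nothing
about the spectrum — only membership in the pseudospectrum) into an eigenvalue enclosure, given a
certified resolvent bound on a surrounding contour (computer-assisted spectral instability proofs
for linearised fluid operators, e.g. the programme of Jia–Šverák 2015 / Guillod–Šverák 2023 for
the self-similar Navier–Stokes linearisation, where the unstable eigenvalue must be located for an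
operator that is far from self-adjoint). The self-adjoint counterpart, where the residual alone
suffices, is `Literature/Analysis/InnerProduct/WeinsteinBound.lean`.

## References

* E. B. Davies, *Linear Operators and their Spectra*, Cambridge Univ. Press 2007, §9.1
  Lemma 9.1.2 (pseudospectra via approximate eigenvectors), §9.2 Thm. 9.2.8 (the resolvent norm
  is subharmonic: no local minimum of `‖A(z)⁻¹‖⁻¹`). [Davies2007]
* L. N. Trefethen, M. Embree, *Spectra and Pseudospectra*, Princeton Univ. Press 2005, §4:
  Thm. 4.1 (stability of bounded invertibility), Thm. 4.2 (the resolvent norm is subharmonic and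
  satisfies the maximum principle on `ρ(A)`), Thm. 4.3 (equivalent definitions (4.3)–(4.5); every
  bounded component of `σ_ε(A)` meets `σ(A)`). [TrefethenEmbree2005]
* T. Kato, *Perturbation Theory for Linear Operators*, Springer 1966, III-§6.1 (holomorphy of
  the resolvent). [Kato1966]
-/

noncomputable section

open _root_.Complex _root_.Metric _root_.Set _root_.Filter _root_.Topology _root_.Bornology

namespace Literature.Analysis.OperatorTheory

variable {A : Type*} [NormedRing A] [NormedAlgebra ℂ A] [CompleteSpace A]

omit [CompleteSpace A] in
/-- **Approximate eigenvectors bound the resolvent norm from below** (one half of Davies'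
Lemma 9.1.2): for `μ ∈ ρ(a)` and any `b`, `‖b‖ ≤ ‖(μ − a)⁻¹‖ · ‖(μ − a) b‖`.
[cite: Davies2007, Lemma 9.1.2] -/
theorem norm_le_norm_resolvent_mul_norm {a : A} {μ : ℂ} (hμ : μ ∈ resolventSet ℂ a) (b : A) :
    ‖b‖ ≤ ‖resolvent a μ‖ * ‖(algebraMap ℂ A μ - a) * b‖ := by
  have h1 : resolvent a μ * (algebraMap ℂ A μ - a) = 1 := Ring.inverse_mul_cancel _ hμ
  calc ‖b‖ = ‖resolvent a μ * ((algebraMap ℂ A μ - a) * b)‖ := by rw [← mul_assoc, h1, one_mul]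
    _ ≤ ‖resolvent a μ‖ * ‖(algebraMap ℂ A μ - a) * b‖ := norm_mul_le _ _

omit [CompleteSpace A] in
/-- **`μ ∈ σ_ε(a)` from an approximate eigenvector**: if `μ ∈ ρ(a)`, `b ≠ 0` and
`‖(μ − a) b‖ ≤ ε ‖b‖`, then `1 ≤ ‖(μ − a)⁻¹‖ ε`. [cite: Davies2007, Lemma 9.1.2] -/
theorem one_le_norm_resolvent_mul_of_approxEigenvector {a b : A} {μ : ℂ} {ε : ℝ}
    (hμ : μ ∈ resolventSet ℂ a) (hb : b ≠ 0) (hres : ‖(algebraMap ℂ A μ - a) * b‖ ≤ ε * ‖b‖) :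
    1 ≤ ‖resolvent a μ‖ * ε := by
  have h1 := norm_le_norm_resolvent_mul_norm hμ b
  have hbpos : 0 < ‖b‖ := norm_pos_iff.mpr hb
  have h2 : ‖b‖ ≤ ‖resolvent a μ‖ * (ε * ‖b‖) :=
    h1.trans (mul_le_mul_of_nonneg_left hres (norm_nonneg _))
  by_contra h
  push Not at h
  nlinarith [norm_nonneg (resolvent a μ)]

/-- The resolvent is holomorphic on an open disc contained in the resolvent set and continuous
on its closure: `DiffContOnCl` for the maximum principle. [folklore] -/
theorem diffContOnCl_resolvent_ball {a : A} {μ : ℂ} {r : ℝ} (hr : r ≠ 0)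
    (h : closedBall μ r ⊆ resolventSet ℂ a) : DiffContOnCl ℂ (resolvent a) (ball μ r) := by
  refine ⟨fun z hz => ?_, ?_⟩
  · exact (spectrum.hasDerivAt_resolvent_const_left
      (h (ball_subset_closedBall hz))).differentiableAt.differentiableWithinAt
  · rw [closure_ball μ hr]
    exact (continuousOn_resolvent a).mono h

/-- **Maximum principle for the resolvent norm on a disc**: if the closed disc `|z − μ| ≤ r`
(`r > 0`) lies in `ρ(a)` and `‖(z − a)⁻¹‖ ≤ M` on the circle `|z − μ| = r`, then
`‖(z − a)⁻¹‖ ≤ M` on the whole closed disc (the norm of a Banach-space-valued holomorphic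
function is subharmonic). [cite: Davies2007, Thm. 9.2.8] -/
theorem norm_resolvent_le_of_closedBall_subset {a : A} {μ : ℂ} {r M : ℝ} (hr : 0 < r)
    (h : closedBall μ r ⊆ resolventSet ℂ a) (hM : ∀ z ∈ sphere μ r, ‖resolvent a z‖ ≤ M)
    {z : ℂ} (hz : z ∈ closedBall μ r) : ‖resolvent a z‖ ≤ M := by
  have hd := diffContOnCl_resolvent_ball hr.ne' h
  refine Complex.norm_le_of_forall_mem_frontier_norm_le isBounded_ball hd (fun w hw => ?_) ?_
  · exact hM w (by rwa [frontier_ball μ hr.ne'] at hw)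
  · rwa [closure_ball μ hr.ne']

/-- **Pseudospectral enclosure.** Let `a` be an element of a complex Banach algebra, `r > 0`,
and suppose `‖(z − a)⁻¹‖ ≤ M` at every point of the circle `|z − μ| = r` (for `z ∈ ρ(a)` this is
the resolvent bound; at a point of `σ(a)` Mathlib's `resolvent a z = 0` and the conclusion below is
trivial anyway). If some `b ≠ 0` is an approximate eigenvector at `μ` with `‖(μ − a) b‖ ≤ ε ‖b‖`
and `M ε < 1`, then the spectrum of `a` meets the closed disc `|z − μ| ≤ r`. (If not, the closed
disc lies in `ρ(a)`, the resolvent is holomorphic on a neighbourhood of it, so `‖(μ − a)⁻¹‖ ≤ M`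
by the maximum principle, while the approximate eigenvector forces `‖(μ − a)⁻¹‖ ≥ ε⁻¹ > M`.)
This is the operator form of "every component of the `ε`-pseudospectrum enclosed by a level
curve `‖R‖ = M < ε⁻¹` contains spectrum". [cite: Davies2007, Lemma 9.1.2 with Thm. 9.2.8; TrefethenEmbree2005, Thm. 4.3] -/
theorem spectrum_inter_closedBall_nonempty_of_norm_resolvent_le {a b : A} {μ : ℂ} {r M ε : ℝ}
    (hr : 0 < r) (hM : ∀ z ∈ sphere μ r, ‖resolvent a z‖ ≤ M)
    (hb : b ≠ 0) (hres : ‖(algebraMap ℂ A μ - a) * b‖ ≤ ε * ‖b‖) (hMε : M * ε < 1) :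
    (spectrum ℂ a ∩ closedBall μ r).Nonempty := by
  by_contra hne
  rw [Set.not_nonempty_iff_eq_empty] at hne
  -- the closed disc lies in the resolvent set
  have hsub : closedBall μ r ⊆ resolventSet ℂ a := by
    intro z hz
    by_contra hz'
    have hzσ : z ∈ spectrum ℂ a ∩ closedBall μ r := ⟨hz', hz⟩
    rw [hne] at hzσ
    exact hzσ
  have hμρ : μ ∈ resolventSet ℂ a := hsub (mem_closedBall_self hr.le)
  -- maximum principle at the centre
  have hμM : ‖resolvent a μ‖ ≤ M :=
    norm_resolvent_le_of_closedBall_subset hr hsub hM (mem_closedBall_self hr.le)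
  -- the approximate eigenvector gives the opposite inequality
  have h1 := one_le_norm_resolvent_mul_of_approxEigenvector hμρ hb hres
  have hε : 0 ≤ ε := by
    have hbpos : 0 < ‖b‖ := norm_pos_iff.mpr hb
    have := (norm_nonneg _).trans hres
    nlinarith
  have : ‖resolvent a μ‖ * ε ≤ M * ε := mul_le_mul_of_nonneg_right hμM hε
  linarith

/-- **Pseudospectral enclosure, normalised residual form**: circle `|z − μ| = r` (`r > 0`) in
`ρ(a)` with `‖(z − a)⁻¹‖ ≤ M` on it, a unit vector `b` with `‖(μ − a) b‖ ≤ ε`, and `M ε < 1`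
imply `σ(a) ∩ {|z − μ| ≤ r} ≠ ∅`. [cite: Davies2007, Lemma 9.1.2 with Thm. 9.2.8] -/
theorem spectrum_inter_closedBall_nonempty_of_norm_resolvent_le' {a b : A} {μ : ℂ} {r M ε : ℝ}
    (hr : 0 < r) (hM : ∀ z ∈ sphere μ r, ‖resolvent a z‖ ≤ M)
    (hb : ‖b‖ = 1) (hres : ‖(algebraMap ℂ A μ - a) * b‖ ≤ ε) (hMε : M * ε < 1) :
    (spectrum ℂ a ∩ closedBall μ r).Nonempty := by
  have hb0 : b ≠ 0 := by
    intro h; rw [h, norm_zero] at hb; exact zero_ne_one hb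
  exact spectrum_inter_closedBall_nonempty_of_norm_resolvent_le hr hM hb0
    (by rwa [hb, mul_one]) hMε

/-- **Contrapositive (exclusion form)**: if the closed disc `|z − μ| ≤ r` (`r > 0`) is free of
spectrum and `‖(z − a)⁻¹‖ ≤ M` on its boundary circle, then every `b` satisfies
`‖b‖ ≤ M ‖(μ − a) b‖` — no approximate eigenvector at `μ` with residual below `M⁻¹` exists.
[cite: Davies2007, Thm. 9.2.8] -/
theorem norm_le_mul_norm_sub_mul_of_closedBall_subset {a : A} {μ : ℂ} {r M : ℝ} (hr : 0 < r)
    (h : closedBall μ r ⊆ resolventSet ℂ a) (hM : ∀ z ∈ sphere μ r, ‖resolvent a z‖ ≤ M)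
    (b : A) : ‖b‖ ≤ M * ‖(algebraMap ℂ A μ - a) * b‖ := by
  have hμ : μ ∈ resolventSet ℂ a := h (mem_closedBall_self hr.le)
  exact (norm_le_norm_resolvent_mul_norm hμ b).trans (mul_le_mul_of_nonneg_right
    (norm_resolvent_le_of_closedBall_subset hr h hM (mem_closedBall_self hr.le)) (norm_nonneg _))

end Literature.Analysis.OperatorTheory
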